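import Summits.KontsevichZagierPeriods.KontsevichZagierPeriods.Theorems.SoloBlindFermatCubic
import Summits.KontsevichZagierPeriods.KontsevichZagierPeriods.Theorems.SoloBlindBoxRankOne
import HarnessLib

/-!
# Regions under rational graphs: the Kontsevich–Zagier conjecture is decided for all of them

Let `p, q ∈ ℚ[x]` with `q > 0` and `p ≥ 0` on `[0,1]`.  The `ℚ`-rational planar region

  `R(p,q) = {(x,y) | 0 < x < 1, 0 ≤ y, y·q(x) ≤ p(x)}`   (area `∫₀¹ p/q`, a `ℚ`-linear combination
  of `1`, logarithms and arctangents of algebraic numbers)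

is ONE Newton–Leibniz move away from the `ℚ`-RATIONAL one-variable representation
`[(0,1), p(x)dx/q(x)]` (`graphRegion_sub_graphLine`), hence its class lies in the cell span `V`
(`mkQ_graphRegion_mem_cellSpan`) and, by Baker injectivity on `V`, **the Kontsevich–Zagier
conjecture holds for every such region** against every representation with class in `V` — all
rational representations of dimension `≤ 1`, all cells, and every other region `R(p',q')`
(`kz_graphRegion`, `kz_graphRegion_graphRegion`).  The values mix `1`, `π` and logarithms freely
(e.g. `∫₀¹ dx/((1+x)(1+x²)) = (log 2)/4 + π/8`); Baker's theorem is what makes the mixed span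
injective.  Worked instance: the triangle `{0 ≤ y ≤ x < 1}` and the curved region
`{y(1+x)² ≤ 1}` both have area `½`, hence are KZ-equivalent (`kz_triangle_invSq`).

References: Kontsevich–Zagier, *Periods* (2001), §1.1–1.2; Baker (1975), Ch. 2. -/

noncomputable section

namespace Summit.KontsevichZagierPeriods.KontsevichZagierPeriods.Theorems

open Set MeasureTheory
open Literature.ModelTheory.ExponentialFields (IsSemialgebraic)
open MvPolynomial (aeval X C)
open Literature.NumberTheory.Transcendental
open Literature.NumberTheory.Transcendental.KZ

namespace SoloBlind

section general

variable (p q : Polynomial ℚ) (hq : ∀ t ∈ Icc (0:ℝ) 1, 0 < Polynomial.aeval t q)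
  (hp : ∀ t ∈ Icc (0:ℝ) 1, 0 ≤ Polynomial.aeval t p)

/-- The graph function `β = p/q`. -/
def graphF (t : ℝ) : ℝ := Polynomial.aeval t p / Polynomial.aeval t q

include hq in
/-- `β` is continuous on `[0,1]`. -/
theorem continuousOn_graphF : ContinuousOn (graphF p q) (Icc 0 1) :=
  (Polynomial.continuous_aeval p).continuousOn.div (Polynomial.continuous_aeval q).continuousOn
    fun t ht => (hq t ht).ne'

include hq in
/-- `β` is integrable on `(0,1)`. -/
theorem integrableOn_graphF : IntegrableOn (graphF p q) (Ioo 0 1) :=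
  ((continuousOn_graphF p q hq).integrableOn_compact isCompact_Icc).mono_set Ioo_subset_Icc_self

include hq hp in
/-- `0 ≤ β` on `(0,1)`. -/
theorem graphF_nonneg {t : ℝ} (ht : t ∈ Ioo (0:ℝ) 1) : 0 ≤ graphF p q t :=
  div_nonneg (hp t (Ioo_subset_Icc_self ht)) (hq t (Ioo_subset_Icc_self ht)).le

/-- A univariate polynomial as a polynomial in the `i`-th of several variables evaluates as
expected. -/
theorem aeval_aeval_X {n : ℕ} (z : Fin n → ℝ) (i : Fin n) (f : Polynomial ℚ) :
    aeval z (Polynomial.aeval (X i : MvPolynomial (Fin n) ℚ) f) = Polynomial.aeval (z i) f := by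
  rw [← Polynomial.aeval_algHom_apply, MvPolynomial.aeval_X]

include hq in
/-- `β` is `ℚ`-semialgebraic on `(0,1)`. -/
theorem isSemialgebraicFunOn_graphF :
    IsSemialgebraicFunOn ℚ (line (Ioo 0 1)) (fun x : Fin 1 → ℝ => graphF p q (x 0)) := by
  have hS := isSemialgebraic_line_Ioo isAlgebraic_zero isAlgebraic_one
  refine (isSemialgebraicFunOn_aeval_div_aeval hS (Polynomial.aeval (X 0) p)
    (Polynomial.aeval (X 0) q) fun x hx => ?_).congr fun x _ => ?_
  · rw [aeval_aeval_X]
    exact (hq _ (Ioo_subset_Icc_self (mem_line.mp hx))).ne'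
  · simp only [aeval_aeval_X, graphF]

/-- **`[(0,1), p dx/q]`**, the one-variable representation. -/
def graphLine : IntegralRep 1 :=
  lineRep (Ioo 0 1) (graphF p q) (isSemialgebraic_line_Ioo isAlgebraic_zero isAlgebraic_one)
    (isSemialgebraicFunOn_graphF p q hq) (integrableOn_graphF p q hq)

/-- `[(0,1), p dx/q]` has KZ's literal rational shape. -/
theorem isRational_graphLine : (graphLine p q hq).IsRational := by
  refine ⟨Polynomial.aeval (X 0) p, Polynomial.aeval (X 0) q, fun x hx => ?_, fun x _ => ?_⟩
  · rw [aeval_aeval_X]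
    exact (hq _ (Ioo_subset_Icc_self (mem_line.mp hx))).ne'
  · show graphF p q (x 0) = _
    simp only [aeval_aeval_X, graphF]

/-- The region `R(p,q) = {0 < x < 1, 0 ≤ y, y·q(x) ≤ p(x)}`. -/
def ratGraph : Set (Fin 2 → ℝ) :=
  {z | (0 < z 0 ∧ z 0 < 1) ∧ 0 ≤ z 1 ∧ z 1 * Polynomial.aeval (z 0) q ≤ Polynomial.aeval (z 0) p}

/-- `R(p,q)` is `ℚ`-semialgebraic. -/
theorem isSemialgebraic_ratGraph : IsSemialgebraic ℚ (ratGraph p q) := by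
  convert isSemialgebraic_subgraph (X 1 * Polynomial.aeval (X 0) q) (Polynomial.aeval (X 0) p)
    using 1
  ext z
  simp [ratGraph, aeval_aeval_X]

include hq in
/-- `R(p,q)` is the region under the graph of `β`. -/
theorem ratGraph_eq :
    ratGraph p q = {z | (0 < z 0 ∧ z 0 < 1) ∧ 0 ≤ z 1 ∧ z 1 ≤ graphF p q (z 0)} := by
  ext z
  simp only [ratGraph, mem_setOf_eq]
  refine and_congr_right fun hx => and_congr_right fun _ => ?_
  rw [graphF, le_div_iff₀ (hq _ ⟨hx.1.le, hx.2.le⟩)]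

include hq in
/-- `R(p,q)` is bounded: it lies in a box `[0, C]²`. -/
theorem ratGraph_subset : ∃ C : ℝ, ratGraph p q ⊆ Icc (0 : Fin 2 → ℝ) (fun _ => C) := by
  obtain ⟨B, hB⟩ := isCompact_Icc.bddAbove_image (continuousOn_graphF p q hq)
  refine ⟨max 1 B, fun z hz => ?_⟩
  rw [ratGraph_eq p q hq] at hz
  obtain ⟨hx, hy, h⟩ := hz
  have hb : graphF p q (z 0) ≤ B := hB (mem_image_of_mem _ ⟨hx.1.le, hx.2.le⟩)
  simp only [mem_Icc, Pi.le_def, Pi.zero_apply, Fin.forall_fin_two]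
  exact ⟨⟨hx.1.le, hy⟩, hx.2.le.trans (le_max_left _ _), (h.trans hb).trans (le_max_right _ _)⟩

include hq in
/-- `1` is integrable on `R(p,q)`. -/
theorem integrableOn_one_ratGraph : IntegrableOn (fun _ : Fin 2 → ℝ => (1:ℝ)) (ratGraph p q) := by
  obtain ⟨C, hC⟩ := ratGraph_subset p q hq
  exact integrableOn_const ((measure_mono hC).trans_lt measure_Icc_lt_top).ne

/-- **`R(p,q) = [{0<x<1, 0≤y, y·q(x)≤p(x)}, 1]`**, with `ℚ`-rational data. -/
def graphRegion : IntegralRep 2 :=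
  ratRep (ratGraph p q) (fun _ => 1) 1 1 (isSemialgebraic_ratGraph p q) (fun _ _ => by simp)
    (fun _ _ => by simp) (integrableOn_one_ratGraph p q hq)

/-- `R(p,q)` has KZ's literal rational shape. -/
theorem isRational_graphRegion : (graphRegion p q hq).IsRational := isRational_ratRep

include hp in
/-- **Move (Newton–Leibniz): `R(p,q) ≡ [(0,1), p dx/q]`.** -/
theorem graphRegion_sub_graphLine :
    of (graphRegion p q hq) - of (graphLine p q hq) ∈ relations :=
  subgraph_sub_lineRep (graphRegion p q hq) (fun _ ht => graphF_nonneg p q hq hp ht)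
    (ratGraph_eq p q hq) rfl

include hp in
/-- **`R(p,q)` lies in the cell span `V`.** -/
theorem mkQ_graphRegion_mem_cellSpan : mkQ (of (graphRegion p q hq)) ∈ cellSpan := by
  rw [mkQ_eq_mkQ_iff.mpr (graphRegion_sub_graphLine p q hq hp)]
  exact mkQ_of_mem_cellSpan _ le_rfl (isRational_graphLine p q hq)

include hp in
/-- **The Kontsevich–Zagier conjecture for `R(p,q)`**, unconditionally, against every
representation with class in `V` (Baker injectivity `eq_zero_of_mem_cellSpan`). -/
theorem kz_graphRegion {m : ℕ} (r' : IntegralRep m) (hr' : mkQ (of r') ∈ cellSpan)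
    (hv : (graphRegion p q hq).value = r'.value) : Equivalent (graphRegion p q hq) r' := by
  rw [Equivalent, ← mkQ_eq_mkQ_iff, ← sub_eq_zero]
  exact eq_zero_of_mem_cellSpan (sub_mem (mkQ_graphRegion_mem_cellSpan p q hq hp) hr')
    (by rw [map_sub, evalQ_mkQ, evalQ_mkQ, eval_of, eval_of, hv, sub_self])

include hp in
/-- In particular against every `ℚ`-rational representation of dimension `≤ 1`. -/
theorem kz_graphRegion_rational {m : ℕ} (hm : m ≤ 1) (r' : IntegralRep m) (hr' : r'.IsRational)
    (hv : (graphRegion p q hq).value = r'.value) : Equivalent (graphRegion p q hq) r' :=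
  kz_graphRegion p q hq hp r' (mkQ_of_mem_cellSpan r' hm hr') hv

include hp in
/-- **Any two regions under rational graphs with the same area are KZ-equivalent.** -/
theorem kz_graphRegion_graphRegion (p' q' : Polynomial ℚ)
    (hq' : ∀ t ∈ Icc (0:ℝ) 1, 0 < Polynomial.aeval t q')
    (hp' : ∀ t ∈ Icc (0:ℝ) 1, 0 ≤ Polynomial.aeval t p')
    (hv : (graphRegion p q hq).value = (graphRegion p' q' hq').value) :
    Equivalent (graphRegion p q hq) (graphRegion p' q' hq') :=
  kz_graphRegion p q hq hp _ (mkQ_graphRegion_mem_cellSpan p' q' hq' hp') hv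

include hp in
/-- `area R(p,q) = ∫₀¹ p/q`, read off from the Newton–Leibniz move. -/
theorem graphRegion_value : (graphRegion p q hq).value =
    ∫ t in (0:ℝ)..1, Polynomial.aeval t p / Polynomial.aeval t q := by
  rw [Equivalent.value_eq_holds (graphRegion_sub_graphLine p q hq hp), graphLine, value_lineRep,
    ← integral_Ioc_eq_integral_Ioo, ← intervalIntegral.integral_of_le zero_le_one]
  rfl

end general

/-! ## Worked instance: the triangle and the region under `1/(1+x)²` -/

/-- `0 < 1` on `[0,1]`, for the constant denominator. -/
theorem aeval_one_pos (t : ℝ) (_ : t ∈ Icc (0:ℝ) 1) :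
    0 < Polynomial.aeval t (1 : Polynomial ℚ) := by
  simp

/-- `0 ≤ x` on `[0,1]`. -/
theorem aeval_X_nonneg (t : ℝ) (ht : t ∈ Icc (0:ℝ) 1) :
    0 ≤ Polynomial.aeval t (Polynomial.X : Polynomial ℚ) := by
  simpa using ht.1

/-- `0 < (1+x)²` on `[0,1]`. -/
theorem aeval_one_add_X_sq_pos (t : ℝ) (ht : t ∈ Icc (0:ℝ) 1) :
    0 < Polynomial.aeval t ((1 + Polynomial.X) ^ 2 : Polynomial ℚ) := by
  have h : (0:ℝ) < 1 + t := by linarith [ht.1]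
  simpa using pow_pos h 2

/-- `0 ≤ 1` on `[0,1]`, for the constant numerator. -/
theorem aeval_one_nonneg (t : ℝ) (_ : t ∈ Icc (0:ℝ) 1) :
    0 ≤ Polynomial.aeval t (1 : Polynomial ℚ) := by
  simp

/-- The triangle `T = {0 < x < 1, 0 ≤ y ≤ x}` as `R(x, 1)`. -/
def triangle : IntegralRep 2 := graphRegion Polynomial.X 1 aeval_one_pos

/-- The curved region `W = {0 < x < 1, 0 ≤ y, y(1+x)² ≤ 1}` as `R(1, (1+x)²)`. -/
def invSq : IntegralRep 2 := graphRegion 1 ((1 + Polynomial.X) ^ 2) aeval_one_add_X_sq_pos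

/-- `area(T) = ½`. -/
theorem triangle_value : triangle.value = 1 / 2 := by
  rw [triangle, graphRegion_value _ _ _ aeval_X_nonneg]
  simp only [Polynomial.aeval_X, map_one, div_one, integral_id]
  norm_num

/-- `area(W) = ∫₀¹ dx/(1+x)² = ½`. -/
theorem invSq_value : invSq.value = 1 / 2 := by
  rw [invSq, graphRegion_value _ _ _ aeval_one_nonneg]
  have hF : ∀ t ∈ uIcc (0:ℝ) 1, HasDerivAt (fun y : ℝ => -(1 + y)⁻¹) (1 / (1 + t) ^ 2) t := by
    intro t ht
    rw [uIcc_of_le zero_le_one] at ht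
    have h0 : (1:ℝ) + t ≠ 0 := by linarith [ht.1]
    refine ((((hasDerivAt_id' t).const_add 1).inv h0).neg).congr_deriv ?_
    field_simp
  have hint : IntervalIntegrable (fun t : ℝ => 1 / (1 + t) ^ 2) volume 0 1 := by
    refine (continuousOn_const.div ?_ fun t ht => ?_).intervalIntegrable_of_Icc zero_le_one
    · exact (continuousOn_const.add continuousOn_id).pow 2
    · have h0 : (0:ℝ) < 1 + t := by linarith [ht.1]
      positivity
  have h := intervalIntegral.integral_eq_sub_of_hasDerivAt hF hint
  have he : (fun t : ℝ => Polynomial.aeval t (1 : Polynomial ℚ) /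
      Polynomial.aeval t ((1 + Polynomial.X) ^ 2 : Polynomial ℚ)) = fun t => 1 / (1 + t) ^ 2 := by
    ext t
    simp
  rw [he, h]
  norm_num

/-- **`T ≡ W`**: the triangle `{0 ≤ y ≤ x < 1}` and the curved region `{y(1+x)² ≤ 1}` are
equivalent under the Kontsevich–Zagier moves (both in `V`, equal areas `½`). -/
theorem kz_triangle_invSq : Equivalent triangle invSq :=
  kz_graphRegion_graphRegion _ _ _ aeval_X_nonneg _ _ _ aeval_one_nonneg
    (show triangle.value = invSq.value by rw [triangle_value, invSq_value])

end SoloBlind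

end Summit.KontsevichZagierPeriods.KontsevichZagierPeriods.Theorems
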